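import Literature.AnabelianGeometry.EtaleTheta.Discharge.Sec3Cor38OfGaloisCoveringConnected
import Literature.AnabelianGeometry.EtaleTheta.Discharge.Sec3Prop34CnstOfRlfQWeak
import Literature.AnabelianGeometry.EtaleTheta.BiKummerThm44SubModelConnectedOfGaloisCovering
import HarnessLib

/-!
# [EtTh] Corollary 3.8 (i) and (ii) AS TYPED, MONOID TYPE `Λ = ℚ`, for tempered Frobenioids with print's divisor monoid over the
# CONSTRUCTED Def. 3.3 (iii) data of the connected coverings (`ofRlfQWeak`) — completing the three monoid types `Λ ∈ {ℤ, ℚ, ℝ}`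

S. Mochizuki, *The étale theta function and its Frobenioid-theoretic manifestations*, Publ. RIMS **45** (2009), Cor. 3.8
(i)/(ii), statement PDF p. 80, proof pp. 81–82 [cite: MochizukiEtTh2009, Cor 3.8 p.80]; Def. 3.3 (iii) p. 73, Rmk. 3.3.1 p. 73,
Prop. 3.4 (ii) p. 74, Def. 3.6 (i)/(ii) pp. 76–77 ("`B₀^ℚ := B₀^pf`, `F₀^ℚ := F₀^pf`"), Ex. 3.9 (iii) p. 84; S. Mochizuki, *The geometry
of Frobenioids I* (2008), Thm. 5.2 (ii) p. 100 [cite: MochizukiFrdI2008, Thm. 5.2(ii) p.100].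

abc-iut cell, layer L2, cone nodes `EtTh:Cor3.8(i)` / `EtTh:Cor3.8(ii)`, seat abc-iut-L2-d2 (gen 5).  PROOF-ONLY (0 definitions) — the
`Λ = ℚ` twin of this seat's `Sec3Cor38OfGaloisCoveringConnected.lean` (p449574, `Λ = ℤ`) and `Sec3Cor38OfGaloisCoveringConnectedR.lean`
(p450744, `Λ = ℝ`), and the (i)/(ii) sibling of the `Λ = ℚ` twins in abc-iut-w6-d052's Cor. 3.8 (iii) knit v3 (p449688): tempered
Frobenioids `C_i` over abc-iut-L6-t12's `ofRlfQWeak (DivisorMonoids.ofGaloisActionConnected A_i hZ_i) hpf_i` (abc-iut-w6-d058's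
constructed Def. 3.3 (iii) data, `B₀^ℚ = B₀^pf`, `F₀^ℚ = F₀^pf`) with print's `Φ_i(B) = ι(Φ₀(Y_B)^pf)`.  The `Λ`-generic weak closers
`Cor38Hyp.cor38_i_weak_of_coord` (abc-iut-w6-d039) / `cor38_ii_weak_of_coord` (abc-iut-L1-t12) are fed, per side:

* `hP34Λ` (every connected covering `Y`, monoid type `ℚ`) := abc-iut-L6-t12's `Prop34Cnst.ofRlfQWeak_mem_FΛ_of_divΛ_eq_of'` over
  abc-iut-w6-d058's THEOREM `DivisorMonoids.prop34_ofGaloisActionConnected` — `hP34Λ_ofGaloisActionConnected_weakQ`;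
* `hFinv` := abc-iut-L6-t12's `ofRlfQWeak_hFinv_of_prop34Const` ⟸ `Prop34Const` (the perfection `F₀^pf` of the group `F₀` is a group);
* `hQ` := `hQ_of_eq_mrange_weakQ` ⟸ (hZQ) at every `Φ₀(Y)` (p449574's `isZQMonoprime_primes_Φ₀_ofGaloisActionConnected`, abc-iut-w6-d057)
  + (hsat) from the Φ-tie (`ratSupport_of_eq_mrange_weakQ`), through abc-iut-L6-t12's `isQMonoprime_pfAt_divisorMonoid_of_ratSupport_weak`;
* `hNZ` := abc-iut-L6-t12's `exists_cnstFn_effective_ofRlfQWeak_of_prop34Const` ⟸ abc-iut-L2-t3's `Prop34Const`;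
* `hF`: binder (§2), ⟸ `IsOfFSMType D` (§3), unconditional at `B^temp(Π)⁰` (§4) — abc-iut-w5-d179's `isFrobenioid_of_isOfFSMType` /
  `isFrobenioid_connectedPart_bTemp` with `DivisorMonoids.ofGaloisActionConnected_ofRlfQWeak_hBinj` (p439044).

RESULTS: `Cor38Hyp.cor38_i/ii_ofGaloisActionConnectedQ_{of_isFrobenioid, of_isOfFSMType, connectedPart_bTemp}_of_eq_mrange` — residual
`h`, the Φ-ties, `Prop34Const_i` [, `IsOfFSMType D_i`]: with p449574 / p450744 the (i)/(ii) closers over the constructed connected data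
exist for ALL THREE monoid types, matching the (iii) knits.  HONEST LABEL: `Prop34Const` (G-L2d2-3) is a property of the geometric
data (proved at the Tate tower p448109 and at the one-component model p449874), a binder here; the Φ-tie is print's choice of `Φ`;
refereed pre-IUT material; nothing here bears on [IUTchIII] Cor. 3.12; no side taken; typed ≠ proved.
-/

noncomputable section

namespace Literature.AnabelianGeometry.EtaleTheta

open CategoryTheory Opposite Function Literature.AlgebraicGeometry.Frobenioids Literature.AnabelianGeometry.SemiGraphs
  LogDivisorModel.GaloisAction

universe u u' v'

/-! ## §1 The print-level inputs at the `ℚ`-type constructed connected data -/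

namespace TemperedFrobenioid

section InputsQ

variable {Z : LogDivisorModel.{u}} {G : Type u} [Group G] (A : Z.GaloisAction G) (hZ : Z.CuspLaws)
  (hpf : ∀ Y : ((isConnectedGSet (G := G)).FullSubcategory)ᵒᵖ,
    IsPerfFactorialCof ((DivisorMonoids.ofGaloisActionConnected A hZ).Φ₀.obj Y))

/-- **`hP34Λ` at monoid type `ℚ` for EVERY connected covering** (Prop. 3.4 (ii) for `B₀^ℚ = B₀^pf`, `F₀^ℚ = F₀^pf`): abc-iut-L6-t12's
`Prop34Cnst.ofRlfQWeak_mem_FΛ_of_divΛ_eq_of'` over abc-iut-w6-d058's THEOREM `DivisorMonoids.prop34_ofGaloisActionConnected`.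
[cite: MochizukiEtTh2009, Prop 3.4 (ii) p.74] -/
theorem hP34Λ_ofGaloisActionConnected_weakQ (Y : ((isConnectedGSet (G := G)).FullSubcategory)ᵒᵖ)
    (b : (RealifiedDivisorMonoids.ofRlfQWeak (DivisorMonoids.ofGaloisActionConnected A hZ) hpf).BΛ.obj Y)
    (r : (RealifiedDivisorMonoids.ofRlfQWeak (DivisorMonoids.ofGaloisActionConnected A hZ) hpf).ΦR.obj Y)
    (h : (RealifiedDivisorMonoids.ofRlfQWeak (DivisorMonoids.ofGaloisActionConnected A hZ) hpf).divΛ Y b =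
      Algebra.GrothendieckGroup.of r) :
    b ∈ (RealifiedDivisorMonoids.ofRlfQWeak (DivisorMonoids.ofGaloisActionConnected A hZ) hpf).FΛ Y :=
  RealifiedDivisorMonoids.Prop34Cnst.ofRlfQWeak_mem_FΛ_of_divΛ_eq_of'
    (DivisorMonoids.prop34_ofGaloisActionConnected A hZ (fun _ => True) fun _ => True) Y b r h

/-- **`hFinv` at monoid type `ℚ` for every connected covering** ⟸ `Prop34Const` (the perfection of the group `F₀(Y) = Hom_G(Y, L^×)` is
a group: abc-iut-L6-t12's `ofRlfQWeak_hFinv_of_prop34Const`). [cite: MochizukiEtTh2009, Prop 3.4 (ii) p.74] -/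
theorem hFinv_ofGaloisActionConnected_weakQ (hC : (DivisorMonoids.ofGaloisActionConnected A hZ).Prop34Const)
    (Y : ((isConnectedGSet (G := G)).FullSubcategory)ᵒᵖ)
    (b : (RealifiedDivisorMonoids.ofRlfQWeak (DivisorMonoids.ofGaloisActionConnected A hZ) hpf).BΛ.obj Y)
    (hb : b ∈ (RealifiedDivisorMonoids.ofRlfQWeak (DivisorMonoids.ofGaloisActionConnected A hZ) hpf).FΛ Y) :
    ∃ b' ∈ (RealifiedDivisorMonoids.ofRlfQWeak (DivisorMonoids.ofGaloisActionConnected A hZ) hpf).FΛ Y, b' * b = 1 :=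
  RealifiedDivisorMonoids.ofRlfQWeak_hFinv_of_prop34Const _ hpf hC Y b hb

variable {A hZ hpf} {D : Type u'} [Category.{v'} D] {VD : FrdICatStub.{u', v', u} D}

/-- **(hsat) from the Φ-tie, monoid type `ℚ`** (the map `Φ₀ → Φ₀^ℝ` of `ofRlfQWeak` is that of `ofRlfZWeak`).
[cite: MochizukiEtTh2009, Ex 3.9 p.84] -/
theorem ratSupport_of_eq_mrange_weakQ
    (CQ : TemperedFrobenioid (RealifiedDivisorMonoids.ofRlfQWeak (DivisorMonoids.ofGaloisActionConnected A hZ) hpf) D VD)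
    (hΦ : ∀ B : Dᵒᵖ, CQ.Φ.carrier B = MonoidHom.mrange (hpf (CQ.baseOp B)).weak.toRealification) (W : D) :
    ∀ x ∈ CQ.Φ.carrier (op W),
      ∃ (N : ℕ+) (d : (DivisorMonoids.ofGaloisActionConnected A hZ).Φ₀.obj (CQ.baseOp (op W))),
        x ^ (N : ℕ) = (RealifiedDivisorMonoids.ofRlfQWeak (DivisorMonoids.ofGaloisActionConnected A hZ) hpf).toR
          (CQ.baseOp (op W)) d := by
  intro x hx
  rw [hΦ] at hx
  obtain ⟨a, rfl⟩ := hx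
  obtain ⟨⟨c, n⟩, rfl⟩ := Perfection.mk_surjective a
  refine ⟨n, c, ?_⟩
  change (hpf _).weak.toRealification (Perfection.mk c n) ^ (n : ℕ) = (hpf _).weak.toRealification (Perfection.of _ c)
  rw [← map_pow, Perfection.mk_pow_self]

/-- **`hQ` (row C38-L05, GAP G-w4d084-3) is a THEOREM for every tempered Frobenioid of monoid type `ℚ` with print's `Φ` over the
constructed connected data**. [cite: MochizukiEtTh2009, Def 3.6 p.77] -/
theorem hQ_of_eq_mrange_weakQ
    (CQ : TemperedFrobenioid (RealifiedDivisorMonoids.ofRlfQWeak (DivisorMonoids.ofGaloisActionConnected A hZ) hpf) D VD)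
    (hΦ : ∀ B : Dᵒᵖ, CQ.Φ.carrier B = MonoidHom.mrange (hpf (CQ.baseOp B)).weak.toRealification) (W : D)
    (𝔮 : Primes (Perfection (CQ.divisorMonoid.obj (op W)))) : IsQMonoprime (PfAt (CQ.divisorMonoid.obj (op W)) 𝔮) :=
  isQMonoprime_pfAt_divisorMonoid_of_ratSupport_weak W
    (fun 𝔭 => isZQMonoprime_primes_Φ₀_ofGaloisActionConnected A hZ _ 𝔭) (CQ.ratSupport_of_eq_mrange_weakQ hΦ W) 𝔮

end InputsQ

end TemperedFrobenioid

namespace Cor38Hyp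

/-! ## §2 Any category vocabularies: residual {`hF_i`, Φ-ties, `Prop34Const_i`} -/

section ConnectedQ

variable {Z : LogDivisorModel.{u}} {G : Type u} [Group G] {A : Z.GaloisAction G} {hZ : Z.CuspLaws}
  {hpf : ∀ Y : ((isConnectedGSet (G := G)).FullSubcategory)ᵒᵖ,
    IsPerfFactorialCof ((DivisorMonoids.ofGaloisActionConnected A hZ).Φ₀.obj Y)}
  {Z' : LogDivisorModel.{u}} {G' : Type u} [Group G'] {A' : Z'.GaloisAction G'} {hZ' : Z'.CuspLaws}
  {hpf' : ∀ Y : ((isConnectedGSet (G := G')).FullSubcategory)ᵒᵖ,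
    IsPerfFactorialCof ((DivisorMonoids.ofGaloisActionConnected A' hZ').Φ₀.obj Y)}
  {D : Type u'} [Category.{v'} D] {VD : FrdICatStub.{u', v', u} D}
  {D' : Type u'} [Category.{v'} D'] {VD' : FrdICatStub.{u', v', u} D'}

/-- **[EtTh] Cor. 3.8 (i) AS TYPED, monoid type `ℚ`, for tempered Frobenioids with print's `Φ` over the constructed connected data,
ANY category vocabularies**: residual `h`, `hF_i`, the Φ-ties, `Prop34Const_i`. [cite: MochizukiEtTh2009, Cor 3.8 p.80] -/
theorem cor38_i_ofGaloisActionConnectedQ_of_isFrobenioid_of_eq_mrange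
    {C₁ : TemperedFrobenioid (RealifiedDivisorMonoids.ofRlfQWeak (DivisorMonoids.ofGaloisActionConnected A hZ) hpf) D VD}
    {C₂ : TemperedFrobenioid (RealifiedDivisorMonoids.ofRlfQWeak (DivisorMonoids.ofGaloisActionConnected A' hZ') hpf') D' VD'}
    (h : Cor38Hyp C₁ C₂)
    (hF₁ : PreFrobenioid.IsFrobenioid C₁.toElem) (hF₂ : PreFrobenioid.IsFrobenioid C₂.toElem)
    (hΦ₁ : ∀ B : Dᵒᵖ, C₁.Φ.carrier B = MonoidHom.mrange (hpf (C₁.baseOp B)).weak.toRealification)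
    (hΦ₂ : ∀ B : D'ᵒᵖ, C₂.Φ.carrier B = MonoidHom.mrange (hpf' (C₂.baseOp B)).weak.toRealification)
    (hC₁ : (DivisorMonoids.ofGaloisActionConnected A hZ).Prop34Const)
    (hC₂ : (DivisorMonoids.ofGaloisActionConnected A' hZ').Prop34Const) :
    Literature.AnabelianGeometry.EtaleTheta.Cor38_i
      (fun E _ => Literature.AlgebraicGeometry.Frobenioids.IsFrobeniusSlim E) h :=
  h.cor38_i_weak_of_coord hF₁ hF₂ (TemperedFrobenioid.hP34Λ_ofGaloisActionConnected_weakQ A hZ hpf)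
    (C₁.exists_cnstFn_effective_ofRlfQWeak_of_prop34Const hC₁) (C₁.hQ_of_eq_mrange_weakQ hΦ₁)
    (TemperedFrobenioid.hP34Λ_ofGaloisActionConnected_weakQ A' hZ' hpf')
    (C₂.exists_cnstFn_effective_ofRlfQWeak_of_prop34Const hC₂) (C₂.hQ_of_eq_mrange_weakQ hΦ₂)

/-- **[EtTh] Cor. 3.8 (ii) AS TYPED, monoid type `ℚ`, same data and residual** (`hFinv_i` ⟸ `Prop34Const_i`).
[cite: MochizukiEtTh2009, Cor 3.8 p.81] -/
theorem cor38_ii_ofGaloisActionConnectedQ_of_isFrobenioid_of_eq_mrange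
    {C₁ : TemperedFrobenioid (RealifiedDivisorMonoids.ofRlfQWeak (DivisorMonoids.ofGaloisActionConnected A hZ) hpf) D VD}
    {C₂ : TemperedFrobenioid (RealifiedDivisorMonoids.ofRlfQWeak (DivisorMonoids.ofGaloisActionConnected A' hZ') hpf') D' VD'}
    (h : Cor38Hyp C₁ C₂)
    (hF₁ : PreFrobenioid.IsFrobenioid C₁.toElem) (hF₂ : PreFrobenioid.IsFrobenioid C₂.toElem)
    (hΦ₁ : ∀ B : Dᵒᵖ, C₁.Φ.carrier B = MonoidHom.mrange (hpf (C₁.baseOp B)).weak.toRealification)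
    (hΦ₂ : ∀ B : D'ᵒᵖ, C₂.Φ.carrier B = MonoidHom.mrange (hpf' (C₂.baseOp B)).weak.toRealification)
    (hC₁ : (DivisorMonoids.ofGaloisActionConnected A hZ).Prop34Const)
    (hC₂ : (DivisorMonoids.ofGaloisActionConnected A' hZ').Prop34Const) :
    Literature.AnabelianGeometry.EtaleTheta.Cor38_ii
      (fun E _ Φ => ∀ (B : E) (α : Aut (Over.forget B)),
        (∀ (B' : Over B) (x : Φ.obj (op B'.left)),
          Literature.AlgebraicGeometry.Frobenioids.pull Φ (α.hom.app B') x = x) → α = 1) h :=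
  h.cor38_ii_weak_of_coord hF₁ hF₂ (TemperedFrobenioid.hP34Λ_ofGaloisActionConnected_weakQ A hZ hpf)
    (C₁.exists_cnstFn_effective_ofRlfQWeak_of_prop34Const hC₁) (C₁.hQ_of_eq_mrange_weakQ hΦ₁)
    (TemperedFrobenioid.hFinv_ofGaloisActionConnected_weakQ A hZ hpf hC₁)
    (TemperedFrobenioid.hP34Λ_ofGaloisActionConnected_weakQ A' hZ' hpf')
    (C₂.exists_cnstFn_effective_ofRlfQWeak_of_prop34Const hC₂) (C₂.hQ_of_eq_mrange_weakQ hΦ₂)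
    (TemperedFrobenioid.hFinv_ofGaloisActionConnected_weakQ A' hZ' hpf' hC₂)

end ConnectedQ

/-! ## §3 The genuine category vocabulary over bases of FSM-type: `hF_i` closed -/

section ConnectedQFSM

variable {Z : LogDivisorModel.{u}} {G : Type u} [Group G] {A : Z.GaloisAction G} {hZ : Z.CuspLaws}
  {hpf : ∀ Y : ((isConnectedGSet (G := G)).FullSubcategory)ᵒᵖ,
    IsPerfFactorialCof ((DivisorMonoids.ofGaloisActionConnected A hZ).Φ₀.obj Y)}
  {Z' : LogDivisorModel.{u}} {G' : Type u} [Group G'] {A' : Z'.GaloisAction G'} {hZ' : Z'.CuspLaws}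
  {hpf' : ∀ Y : ((isConnectedGSet (G := G')).FullSubcategory)ᵒᵖ,
    IsPerfFactorialCof ((DivisorMonoids.ofGaloisActionConnected A' hZ').Φ₀.obj Y)}
  {D : Type u'} [Category.{v'} D] {IsRational IsStrictlyRational : (Dᵒᵖ ⥤ CommMonCat.{u}) → Prop}
  {D' : Type u'} [Category.{v'} D'] {IsRational' IsStrictlyRational' : (D'ᵒᵖ ⥤ CommMonCat.{u}) → Prop}
  {C₁ : TemperedFrobenioid
    (RealifiedDivisorMonoids.ofRlfQWeak (DivisorMonoids.ofGaloisActionConnected A hZ) hpf) D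
    (treeCatVocab D IsRational IsStrictlyRational)}
  {C₂ : TemperedFrobenioid
    (RealifiedDivisorMonoids.ofRlfQWeak (DivisorMonoids.ofGaloisActionConnected A' hZ') hpf') D'
    (treeCatVocab D' IsRational' IsStrictlyRational')}

/-- **[EtTh] Cor. 3.8 (i) ∧ (ii) AS TYPED, monoid type `ℚ`, at the constructed connected data over bases of FSM-type** — `hF_i` CLOSED
(abc-iut-w5-d179's `isFrobenioid_of_isOfFSMType` with `DivisorMonoids.ofGaloisActionConnected_ofRlfQWeak_hBinj`); residual: `h`, the
Φ-ties, `Prop34Const_i`, `IsOfFSMType D_i`. [cite: MochizukiEtTh2009, Cor 3.8 p.80] -/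
theorem cor38_i_ii_ofGaloisActionConnectedQ_of_isOfFSMType_of_eq_mrange (h : Cor38Hyp C₁ C₂)
    (hD : IsOfFSMType D) (hD' : IsOfFSMType D')
    (hΦ₁ : ∀ B : Dᵒᵖ, C₁.Φ.carrier B = MonoidHom.mrange (hpf (C₁.baseOp B)).weak.toRealification)
    (hΦ₂ : ∀ B : D'ᵒᵖ, C₂.Φ.carrier B = MonoidHom.mrange (hpf' (C₂.baseOp B)).weak.toRealification)
    (hC₁ : (DivisorMonoids.ofGaloisActionConnected A hZ).Prop34Const)
    (hC₂ : (DivisorMonoids.ofGaloisActionConnected A' hZ').Prop34Const) :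
    Literature.AnabelianGeometry.EtaleTheta.Cor38_i
        (fun E _ => Literature.AlgebraicGeometry.Frobenioids.IsFrobeniusSlim E) h ∧
      Literature.AnabelianGeometry.EtaleTheta.Cor38_ii
        (fun E _ Φ => ∀ (B : E) (α : Aut (Over.forget B)),
          (∀ (B' : Over B) (x : Φ.obj (op B'.left)),
            Literature.AlgebraicGeometry.Frobenioids.pull Φ (α.hom.app B') x = x) → α = 1) h :=
  have hF₁ := C₁.isFrobenioid_of_isOfFSMType (DivisorMonoids.ofGaloisActionConnected_ofRlfQWeak_hBinj A hZ hpf) hD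
  have hF₂ := C₂.isFrobenioid_of_isOfFSMType (DivisorMonoids.ofGaloisActionConnected_ofRlfQWeak_hBinj A' hZ' hpf') hD'
  ⟨h.cor38_i_ofGaloisActionConnectedQ_of_isFrobenioid_of_eq_mrange hF₁ hF₂ hΦ₁ hΦ₂ hC₁ hC₂,
    h.cor38_ii_ofGaloisActionConnectedQ_of_isFrobenioid_of_eq_mrange hF₁ hF₂ hΦ₁ hΦ₂ hC₁ hC₂⟩

end ConnectedQFSM

/-! ## §4 The GENUINE bases `B^temp(Π)⁰`: residual {Φ-ties, `Prop34Const_i`} -/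

section ConnectedQGenuineBase

variable {Z : LogDivisorModel.{u}} {G : Type u} [Group G] {A : Z.GaloisAction G} {hZ : Z.CuspLaws}
  {hpf : ∀ Y : ((isConnectedGSet (G := G)).FullSubcategory)ᵒᵖ,
    IsPerfFactorialCof ((DivisorMonoids.ofGaloisActionConnected A hZ).Φ₀.obj Y)}
  {Z' : LogDivisorModel.{u}} {G' : Type u} [Group G'] {A' : Z'.GaloisAction G'} {hZ' : Z'.CuspLaws}
  {hpf' : ∀ Y : ((isConnectedGSet (G := G')).FullSubcategory)ᵒᵖ,
    IsPerfFactorialCof ((DivisorMonoids.ofGaloisActionConnected A' hZ').Φ₀.obj Y)}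
  {P : Type v'} [Group P] [TopologicalSpace P]
  {IsRational IsStrictlyRational : ((ConnectedPart (BTemp P))ᵒᵖ ⥤ CommMonCat.{u}) → Prop}
  {P' : Type v'} [Group P'] [TopologicalSpace P']
  {IsRational' IsStrictlyRational' : ((ConnectedPart (BTemp P'))ᵒᵖ ⥤ CommMonCat.{u}) → Prop}
  {C₁ : TemperedFrobenioid
    (RealifiedDivisorMonoids.ofRlfQWeak (DivisorMonoids.ofGaloisActionConnected A hZ) hpf)
    (ConnectedPart (BTemp P)) (treeCatVocab (ConnectedPart (BTemp P)) IsRational IsStrictlyRational)}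
  {C₂ : TemperedFrobenioid
    (RealifiedDivisorMonoids.ofRlfQWeak (DivisorMonoids.ofGaloisActionConnected A' hZ') hpf')
    (ConnectedPart (BTemp P')) (treeCatVocab (ConnectedPart (BTemp P')) IsRational' IsStrictlyRational')}

/-- **[EtTh] Cor. 3.8 (i) ∧ (ii) AS TYPED, monoid type `ℚ`, at the constructed connected data over the GENUINE bases `B^temp(Π)⁰`,
`B^temp(Π′)⁰`** (`hF_i` UNCONDITIONAL: `isFrobenioid_connectedPart_bTemp`); residual = `h`, the Φ-ties, `Prop34Const_i` — nothing else.
[cite: MochizukiEtTh2009, Cor 3.8 p.80] -/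
theorem cor38_i_ii_ofGaloisActionConnectedQ_connectedPart_bTemp_of_eq_mrange (h : Cor38Hyp C₁ C₂)
    (hΦ₁ : ∀ B : (ConnectedPart (BTemp P))ᵒᵖ,
      C₁.Φ.carrier B = MonoidHom.mrange (hpf (C₁.baseOp B)).weak.toRealification)
    (hΦ₂ : ∀ B : (ConnectedPart (BTemp P'))ᵒᵖ,
      C₂.Φ.carrier B = MonoidHom.mrange (hpf' (C₂.baseOp B)).weak.toRealification)
    (hC₁ : (DivisorMonoids.ofGaloisActionConnected A hZ).Prop34Const)
    (hC₂ : (DivisorMonoids.ofGaloisActionConnected A' hZ').Prop34Const) :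
    Literature.AnabelianGeometry.EtaleTheta.Cor38_i
        (fun E _ => Literature.AlgebraicGeometry.Frobenioids.IsFrobeniusSlim E) h ∧
      Literature.AnabelianGeometry.EtaleTheta.Cor38_ii
        (fun E _ Φ => ∀ (B : E) (α : Aut (Over.forget B)),
          (∀ (B' : Over B) (x : Φ.obj (op B'.left)),
            Literature.AlgebraicGeometry.Frobenioids.pull Φ (α.hom.app B') x = x) → α = 1) h :=
  have hF₁ := C₁.isFrobenioid_connectedPart_bTemp (DivisorMonoids.ofGaloisActionConnected_ofRlfQWeak_hBinj A hZ hpf)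
  have hF₂ := C₂.isFrobenioid_connectedPart_bTemp (DivisorMonoids.ofGaloisActionConnected_ofRlfQWeak_hBinj A' hZ' hpf')
  ⟨h.cor38_i_ofGaloisActionConnectedQ_of_isFrobenioid_of_eq_mrange hF₁ hF₂ hΦ₁ hΦ₂ hC₁ hC₂,
    h.cor38_ii_ofGaloisActionConnectedQ_of_isFrobenioid_of_eq_mrange hF₁ hF₂ hΦ₁ hΦ₂ hC₁ hC₂⟩

end ConnectedQGenuineBase

end Cor38Hyp

end Literature.AnabelianGeometry.EtaleTheta

end
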